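import Summits.Ventures.HSemireg.WedgeHankelSubstitutionSingular

/-!
# Venture HSemireg — THE CLASS SPACE SPLITS UNDER A SINGULAR SUBSTITUTION: for `αδ = βγ`, `α + δ ≠ 0` the kernel and the image of `SbC(g)` are COMPLEMENTARY
# (`IsCompl`), the image is an eigen-line with eigenvalue `(α+δ)^n`, and `SbC(g) = (α+δ)^n ·` (the projection onto the image along the kernel); for a
# nilpotent letter map (`α + δ = 0`, `n ≥ 1`) the image lies INSIDE the kernel

HONEST FRAMING. Part of the Lean index of the computation cell `pub-hsemireg` (seat p10 gen 19, Sunday typer «UNIFORM-IN-n»).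
Finite-dimensional EXTERIOR ALGEBRA + linear algebra ONLY: no variety, no cohomology theory, no sheaf, no Ext group, no semiregularity map;
nothing here says that HC / HC_CM / HC_AV holds; no Literature fact is declared or used.  Custodian versions as in `WedgeHankelSiegelIdeal` (1/3) and `WedgeHankelFrameChange`.

WHAT IS IN THE TREE.  I20 (`WedgeHankelSubstitutionSingular`): `SbC(g)·SbC(g) = (α+δ)^n · SbC(g)` for `αδ = βγ`, `SbC_SbC_apply_of_det_eq_zero`; I12: for `α ≠ 0` the image is
the pure LINE of `x + (β/α)y` (`finrank 1`) and the kernel the HYPERPLANE `c(q) = 0` (`finrank n`).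
THIS FILE (namespace `…Wedge.HankelFrameChange` continued; imports I20) draws the consequence of `T·T = λ·T` on th-7's class space:
* §218 **`SbC_apply_of_mem_range`** (`f ∈ range SbC(g) ⇒ SbC(g) f = (α+δ)^n · f`: the image is an eigen-space), **`range_SbC_le_ker_of_nilpotent`** (`α + δ = 0`,
  `n ≥ 1` ⇒ `range ≤ ker`), and for `α + δ ≠ 0`: `ker_SbC_inf_range_eq_bot`, `ker_SbC_sup_range_eq_top`, **`isCompl_ker_range_SbC_of_det_eq_zero`** — the class space
  is `ker SbC(g) ⊕ range SbC(g)` (with I12: hyperplane ⊕ line), i.e. `((α+δ)^n)⁻¹ · SbC(g)` is THE projection onto the image along the kernel.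
NOT typed here: the trace `(α+δ)^n`; anything Ext-side.  New names only.
-/

open Module

namespace Summit.Ventures.HSemireg.Wedge.HankelFrameChange

open Summit.Ventures.HSemireg.Wedge Summit.Ventures.HSemireg.Wedge.Kunneth Summit.Ventures.HSemireg.Wedge.Hankel
  Summit.Ventures.HSemireg.Wedge.BasisFree Summit.Ventures.HSemireg.Wedge.HankelSiegel Summit.Ventures.HSemireg.Wedge.HankelSiegelIdeal
  Summit.Ventures.HSemireg.Wedge.KunnethKernel Summit.Ventures.HSemireg.Wedge.HankelRankOne Summit.Ventures.HSemireg.Wedge.KernelDuality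

variable (K : Type*) [Field K] {n : ℕ}

/-! ## §218. Kernel and image of a singular substitution on the classes -/

/-- **the image of a singular substitution is an eigen-space: `SbC(g) f = (α+δ)^n · f` for `f ∈ range SbC(g)`** (`αδ = βγ`). -/
theorem SbC_apply_of_mem_range {α β γ δ : K} (hdet : α * δ - β * γ = 0) {f : spikeSpan K n}
    (hf : f ∈ LinearMap.range (SbC K α β γ δ (n := n))) : SbC K α β γ δ f = (α + δ) ^ n • f := by
  obtain ⟨g, rfl⟩ := hf
  exact SbC_SbC_apply_of_det_eq_zero K hdet g

/-- **a NILPOTENT letter map (`αδ = βγ`, `α + δ = 0`, `n ≥ 1`) has `range SbC(g) ≤ ker SbC(g)`** on the classes. -/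
theorem range_SbC_le_ker_of_nilpotent {α β γ δ : K} (hdet : α * δ - β * γ = 0) (htr : α + δ = 0) (hn : 1 ≤ n) :
    LinearMap.range (SbC K α β γ δ (n := n)) ≤ LinearMap.ker (SbC K α β γ δ) := by
  intro f hf
  rw [LinearMap.mem_ker, SbC_apply_of_mem_range K hdet hf, htr, zero_pow (by omega), zero_smul]

/-- `ker SbC(g) ⊓ range SbC(g) = ⊥` for `αδ = βγ`, `α + δ ≠ 0`. -/
theorem ker_SbC_inf_range_eq_bot {α β γ δ : K} (hdet : α * δ - β * γ = 0) (htr : α + δ ≠ 0) :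
    LinearMap.ker (SbC K α β γ δ (n := n)) ⊓ LinearMap.range (SbC K α β γ δ) = ⊥ := by
  rw [Submodule.eq_bot_iff]
  rintro f ⟨hk, hr⟩
  have e := SbC_apply_of_mem_range K hdet hr
  rw [LinearMap.mem_ker.mp hk, eq_comm, smul_eq_zero] at e
  exact e.resolve_left (pow_ne_zero _ htr)

/-- `ker SbC(g) ⊔ range SbC(g) = ⊤` for `αδ = βγ`, `α + δ ≠ 0` (`f = (f − t⁻ⁿ·SbC(g) f) + t⁻ⁿ·SbC(g) f`). -/
theorem ker_SbC_sup_range_eq_top {α β γ δ : K} (hdet : α * δ - β * γ = 0) (htr : α + δ ≠ 0) :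
    LinearMap.ker (SbC K α β γ δ (n := n)) ⊔ LinearMap.range (SbC K α β γ δ) = ⊤ := by
  rw [Submodule.eq_top_iff']
  intro f
  have hu : (α + δ) ^ n ≠ 0 := pow_ne_zero _ htr
  have e : f = (f - ((α + δ) ^ n)⁻¹ • SbC K α β γ δ f) + ((α + δ) ^ n)⁻¹ • SbC K α β γ δ f := by rw [sub_add_cancel]
  rw [e]
  refine Submodule.add_mem_sup ?_ (Submodule.smul_mem _ _ (LinearMap.mem_range_self _ f))
  rw [LinearMap.mem_ker, map_sub, map_smul, SbC_SbC_apply_of_det_eq_zero K hdet, smul_smul, inv_mul_cancel₀ hu, one_smul, sub_self]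

/-- **THE CLASS SPACE SPLITS: `ker SbC(g)` and `range SbC(g)` are complementary for `αδ = βγ`, `α + δ ≠ 0`** — with I12 (for `α ≠ 0`): the hyperplane `c(q) = 0` ⊕ the pure
line of the image letter, and `((α+δ)^n)⁻¹ · SbC(g)` is the projection onto the line along the hyperplane (I20 `SbC_idempotent_of_det_eq_zero`). -/
theorem isCompl_ker_range_SbC_of_det_eq_zero {α β γ δ : K} (hdet : α * δ - β * γ = 0) (htr : α + δ ≠ 0) :
    IsCompl (LinearMap.ker (SbC K α β γ δ (n := n))) (LinearMap.range (SbC K α β γ δ)) :=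
  ⟨disjoint_iff.mpr (ker_SbC_inf_range_eq_bot K hdet htr), codisjoint_iff.mpr (ker_SbC_sup_range_eq_top K hdet htr)⟩

/-- dimension count of the splitting: `dim ker + dim range = n + 1` (rank–nullity on the class space, `dim = n + 1`). -/
theorem finrank_ker_add_finrank_range_SbC (α β γ δ : K) :
    finrank K (LinearMap.ker (SbC K α β γ δ (n := n))) + finrank K (LinearMap.range (SbC K α β γ δ (n := n))) = n + 1 := by
  rw [add_comm, LinearMap.finrank_range_add_finrank_ker, finrank_eq_card_basis (spikeBasis K n), Fintype.card_fin]

end Summit.Ventures.HSemireg.Wedge.HankelFrameChange
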